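import Summits.ResolutionOfSingularities.ResolutionOfSingularities.Theorems.PurelyInseparableDim4ResConeCInfPinningU
import Summits.ResolutionOfSingularities.ResolutionOfSingularities.Theorems.PurelyInseparableDim4ResConeCInfNoFreeChart
import Summits.ResolutionOfSingularities.ResolutionOfSingularities.Theorems.PurelyInseparableDim4ResConeCInfGameStep
import Summits.ResolutionOfSingularities.ResolutionOfSingularities.Theorems.PurelyInseparableDim4ResConeCInfNormalForm
import Summits.ResolutionOfSingularities.ResolutionOfSingularities.Theorems.PurelyInseparableDim4ResConeVertexTop
import HarnessLib

/-!
# Purely inseparable four-folds — the C∞ FRAME STEP: one pure corner reproduces the frame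
# (K24b-FRAME, file F2c part 1 «window sub-image law, frame side»: cell `res-dim4-pi`, K2(p) lane, slice B)

[OURS · counted 0 · cell `res-dim4-pi` · K2(p) lane holder res-dim4-p-12 g3's split of K24b by file (bus
2026-08-29 02:23:39Z; owners 03:02:06Z/03:23:53Z: F2 = res-dim4-p-2 g4), design ruling (iii) 02:51:49Z («local
window, re-framed at the letter change»); consumes res-dim4-typ-1 g2's F1 (P) `…ResConeCInfNormalForm` and (via
the package identity) (VT-f), res-dim4-p-2 g4's (VT-u) `…ResConeCInfPinningU`, F2a `…ResConeCInfGameStep`, F2b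
`…ResConeCInfNoFreeChart`, res-dim4-p-9's power-cone package and tilt identity (`…ResConePowerChain(Tilt)`).]
Nothing here proves K2(p)/K2(5), `NoIsolatedTrap 5 5` or resolution of singularities in dimension ≥ 4 /
characteristic `p` — NOT proved.  AI kernel work, weaker than expert review.

THE FRAME at a stage `k` of a shade-`4` power-cone stretch (`p = 5`, letters `λ, μ, u, f`, jet parameter `N`):
straight vertex form (`ℓ_k = ℓ_f e_f`), ledger `r_k = x_λ x_μ`, pair-ledger divisibility below degree `N`
(monomials of `f`-degree `≤ 3` are divisible by `x_λ² x_μ²`), dead `ū²`-row below degree `N`, `u`-axis flag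
`coeff (r + λ + μ + 3u) F_k ≠ 0`.
* §2 **`cInf_frame_step`**: at a framed stage with chart `λ` (and `|r_{k+1}| = 2`, `N ≥ 8`) the step is a PURE
  CORNER — `b_k = 0`: chart letter; kept letter by `|r′| = 2`; contact letter by the package identity
  (`translation_contact_eq_zero_of_straight`); free letter by (VT-u) `cInf_translation_u_eq_zero`, whose three
  readings are frame entries of degree `7 < N` — and the frame is REPRODUCED at `k + 1` with parameter `N − 4`:
  `r′ = r` (`cInf_step_zero_r`), `ℓ′` straight (tilt identity at `x_f³`: `a′·4·ℓ′_λ·λ³·ℓ_f³ = c·coeff_{x^r x_λ² f³} F_k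
  = 0` by the ledger jet), jets by `ledger_step_zero` / `row_step_zero`, flag by `cInf_uFlag_step_zero`.
* (file `…ResConeCInfFrameWindow`) **`cInf_frame_window`**: induction — from a framed stage `k` with parameter `N`, for every `t` with
  `4t + 8 ≤ N` the frame holds at `k + t` with parameter `N − 4t` and the step at `k + t` is a pure `λ/μ`-corner
  (`j_{k+t} ∈ {λ, μ}` by `cInf_chart_eq_or_eq`, `b_{k+t} = 0`, `c_{k+t+1} = CentreBlowup.step 5 univ j_{k+t} 0 c_{k+t}`).
  With F2a this feeds `CInfGame.Window.no_play_after_change` (res-dim4-p-9 g3) its `hfwdL/hfwdM/hevol` on the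
  window; legality and flags are F3 (res-dim4-p-3 g3, `…` p692149); the window START is the one-state re-framing
  (res-dim4-p-1 g4 β1, res-dim4-typ-1 g3 (E-u)/βC3(d)) — all by value here.
bears_on: LADDER-RESOLUTION:D157-DOOR2 (res-dim4-pi · K2(p) · slice B · K24b-FRAME F2c).  Supports
stmt-ResolutionOfSingularities-16155 (helper).
-/

set_option linter.dupNamespace false -- mandated namespace of this single-conjunct summit

namespace Summit.ResolutionOfSingularities.ResolutionOfSingularities.Theorems.PIDim4

namespace ResCone

open MvPolynomial Finset
open Literature.AlgebraicGeometry.Resolution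
open Literature.AlgebraicGeometry.Resolution.CentreBlowup
open Literature.AlgebraicGeometry.Resolution.Hauser2010
open Literature.AlgebraicGeometry.Resolution.HauserPerlega2019

variable {K : Type} [Field K]

/-! ## 1. The straight initial form -/

section Straight

/-- A straight power cone `C a · (ℓ_f x_f)⁴` over the ledger `x^r` has the single initial monomial
`x^r x_f⁴`. [OURS · bookkeeping] -/
theorem initialForm_eq_monomial_of_straight {s : State K} (hdiv : ∀ d ∈ s.F.support, s.r ≤ d)
    {ℓ : Fin 4 → K} {a : K} (hform : resForm s = C a * (∑ i, C (ℓ i) * X i) ^ 4) {f : Fin 4}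
    (hstraight : ∀ i, i ≠ f → ℓ i = 0) :
    initialForm s.F = monomial (s.r + Finsupp.single f 4) (a * ℓ f ^ 4) := by
  have hsum : (∑ i, C (ℓ i) * X i : MvPolynomial (Fin 4) K) = C (ℓ f) * X f := by
    rw [Finset.sum_eq_single f]
    · intro i _ hif; rw [hstraight i hif, C_0, zero_mul]
    · intro h; exact absurd (Finset.mem_univ f) h
  rw [← monomial_mul_resForm hdiv, hform, hsum, mul_pow, ← C_pow, X_pow_eq_monomial, C_mul_monomial,
    C_mul_monomial, monomial_mul, one_mul, mul_one]

/-- Hence every monomial of `f`-degree `≤ 3` of a straight C∞ state (order `6`) has degree `≥ 7`. [OURS] -/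
theorem seven_le_degree_of_straight {s : State K} (ho : ordZero s.F = (6 : ℕ)) (hdiv : ∀ d ∈ s.F.support, s.r ≤ d)
    {ℓ : Fin 4 → K} {a : K} (hform : resForm s = C a * (∑ i, C (ℓ i) * X i) ^ 4) {f : Fin 4}
    (hstraight : ∀ i, i ≠ f → ℓ i = 0) (hrf : s.r f = 0) :
    ∀ d ∈ s.F.support, d f ≤ 3 → 7 ≤ d.degree := by
  intro d hd hdf
  have h6 := le_degree_of_mem_support_of_ordZero ho hd
  by_contra hlt
  have hdeg : d.degree = 6 := by omega
  have hcoeff := mem_support_iff.mp hd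
  rw [← NarrowApolarity.coeff_initialForm_of_degree_eq ho hdeg, initialForm_eq_monomial_of_straight hdiv hform hstraight,
    coeff_monomial] at hcoeff
  by_cases heq : s.r + Finsupp.single f 4 = d
  · have h := DFunLike.congr_fun heq f
    rw [Finsupp.add_apply, hrf, Finsupp.single_eq_same] at h
    omega
  · rw [if_neg heq] at hcoeff
    exact hcoeff rfl

end Straight

/-! ## 2. One step of the C∞ frame -/

section Chain

variable [CharP K 5] [DecidableEq K]

/-- **THE C∞ FRAME STEP** (K24b-FRAME F2c, one step; chart-`λ` form — the chart-`μ` form is the same statement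
with `(λ, μ)` swapped, the frame being symmetric).  On a shade-`4` power-cone stretch at `p = 5` with the package
data at stages `k, k+1` (`ℓ ≠ 0`, `resForm_k = a·ℓ⁴`, `ℓ_{j_k} + ℓ ⬝ᵥ b_k = 0`, `ℓ′ = λ·ℓ` off the chart letter,
`λ ≠ 0`, `resForm_{k+1} = a′·ℓ′⁴`), chart `j_k = λ`, and the FRAME at stage `k` with jet parameter `N ≥ 8` —
straight `ℓ`, ledger `r_k = x_λ x_μ`, `|r_{k+1}| = 2`, pair-ledger divisibility and dead `ū²`-row below degree
`N`, `u`-axis flag `V ≠ 0` — the step is a PURE CORNER (`b_k = 0`: chart letter, kept letter by `|r′| = 2`,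
(VT-f) `translation_contact_eq_zero_of_straight`, (VT-u) `cInf_translation_u_eq_zero`), and the frame is
REPRODUCED at stage `k + 1` with jet parameter `N − 4`: same ledger (`cInf_step_zero_r`), straight `ℓ′`
(tilt identity at `x_f³`: `a′·4·ℓ′_λ·λ³·ℓ_f³ = c · coeff_{x^r x_λ² x_f³} F_k = 0` by the ledger reading),
pair-ledger divisibility and dead `ū²`-row below `N − 4` (`ledger_step_zero`, `row_step_zero`), flag carried
(`cInf_uFlag_step_zero`). [OURS] [cite: CossartJannsenSaito2020, Thm. 3.10(4), Thm. 9.3] -/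
theorem cInf_frame_step {c : ℕ → State K} {j : ℕ → Fin 4} {b : ℕ → Fin 4 → K}
    (hc : ∀ k, IsIsolated 5 (c k).F ∧ Step0 5 (c k) (c (k + 1))) (hw : FreeTail.IsWitnessedChain 5 c j b)
    (hr0 : ∀ e ∈ (c 0).F.support, (c 0).r ≤ e) (hfloor : ∀ k, ordZero (c k).F ≠ (5 : ℕ)) {k₀ : ℕ}
    (hshade : ∀ k, k₀ ≤ k → (c k).shade = ((4 : ℕ) : ℕ∞)) {k : ℕ} (hk : k₀ ≤ k)
    {ℓ ℓ' : Fin 4 → K} {a a' lam : K} (hℓ : ℓ ≠ 0) (hform : resForm (c k) = C a * (∑ i, C (ℓ i) * X i) ^ 4)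
    (hchart : ℓ (j k) + dotProduct ℓ (b k) = 0) (hlam0 : lam ≠ 0) (hlam : ∀ i, i ≠ j k → ℓ' i = lam * ℓ i)
    (hform' : resForm (c (k + 1)) = C a' * (∑ i, C (ℓ' i) * X i) ^ 4)
    {la mu u f : Fin 4} (hlm : la ≠ mu) (hlu : la ≠ u) (hlf : la ≠ f) (hmu : mu ≠ u) (hmf : mu ≠ f)
    (huf : u ≠ f) (hjl : j k = la) (hstraight : ∀ i, i ≠ f → ℓ i = 0)
    (hr : (c k).r = Finsupp.single la 1 + Finsupp.single mu 1) (hw2 : (c (k + 1)).r.degree = 2) {N : ℕ}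
    (hN : 8 ≤ N) (hled : ∀ d ∈ (c k).F.support, d f ≤ 3 → d.degree < N → 2 ≤ d la ∧ 2 ≤ d mu)
    (hrow : ∀ d ∈ (c k).F.support, d.degree < N → ¬ (d u = 2 ∧ d f = 0))
    (hV : coeff ((c k).r + (Finsupp.single la 1 + Finsupp.single mu 1 + Finsupp.single u 3)) (c k).F ≠ 0) :
    b k = 0 ∧ c (k + 1) = CentreBlowup.step 5 Finset.univ la 0 (c k) ∧
      (c (k + 1)).r = Finsupp.single la 1 + Finsupp.single mu 1 ∧ (∀ i, i ≠ f → ℓ' i = 0) ∧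
      (∀ d ∈ (c (k + 1)).F.support, d f ≤ 3 → d.degree < N - 4 → 2 ≤ d la ∧ 2 ≤ d mu) ∧
      (∀ d ∈ (c (k + 1)).F.support, d.degree < N - 4 → ¬ (d u = 2 ∧ d f = 0)) ∧
      coeff ((c (k + 1)).r + (Finsupp.single la 1 + Finsupp.single mu 1 + Finsupp.single u 3))
        (c (k + 1)).F ≠ 0 := by
  haveI : Fact (Nat.Prime 5) := ⟨by norm_num⟩
  subst hjl
  -- band data at stage `k`
  obtain ⟨o, ho, -, -, hod⟩ := chain_shade_nat 5 hc hfloor hshade hk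
  have hrdeg : (c k).r.degree = 2 := by rw [hr, map_add, Finsupp.degree_single, Finsupp.degree_single]
  have ho6 : o = 6 := by omega
  subst ho6
  have hbj : b k (j k) = 0 := (hw k).2.1
  have hstepw : c (k + 1) = CentreBlowup.step 5 Finset.univ (j k) (b k) (c k) := (hw k).2.2.2.2
  have hdivk := IsolatedBand.isolated_chain_forall_le hc hr0 k
  have hdivk1 := IsolatedBand.isolated_chain_forall_le hc hr0 (k + 1)
  have hrv : (c k).r (j k) = 1 ∧ (c k).r mu = 1 ∧ (c k).r u = 0 ∧ (c k).r f = 0 := by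
    rw [hr, show (Finsupp.single (j k) 1 + Finsupp.single mu 1 : Fin 4 →₀ ℕ) =
      Finsupp.single (j k) 1 + Finsupp.single mu 1 + Finsupp.single u 0 + Finsupp.single f 0 by
        rw [Finsupp.single_zero, Finsupp.single_zero, add_zero, add_zero]]
    exact quad_apply hlm hlu hlf hmu hmf huf 1 1 0 0
  obtain ⟨hrl, hrm, hru, hrf⟩ := hrv
  -- readings at `r + m` as four-letter exponents
  have hradd : ∀ x y z : ℕ, (c k).r + (Finsupp.single (j k) x + Finsupp.single mu y + Finsupp.single u z) =
      Finsupp.single (j k) (1 + x) + Finsupp.single mu (1 + y) + Finsupp.single u z + Finsupp.single f 0 := by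
    intro x y z
    rw [hr, Finsupp.single_add, Finsupp.single_add, Finsupp.single_zero, add_zero]
    abel
  -- (VT-f): the contact letter is untranslated
  have hbf : b k f = 0 := translation_contact_eq_zero_of_straight hℓ hstraight hlf hchart
  -- the kept letter is untranslated (`|r′| = 2`)
  have hbm : b k mu = 0 := by
    by_contra hne
    have h1 : (c (k + 1)).r = Finsupp.single (j k) 1 + Finsupp.single mu 0 + Finsupp.single u 0 +
        Finsupp.single f 0 := by
      obtain ⟨h1, h2, h3, h4⟩ := quad_apply hlm hlu hlf hmu hmf huf 1 0 0 0
      rw [hstepw, step_r_univ 5 (j k) hbj (c k) ho hdivk]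
      ext i
      rw [Finsupp.update_apply, Finsupp.filter_apply]
      rcases letters_exhaust hlm hlu hlf hmu hmf huf i with h | h | h | h <;> rw [h]
      · rw [if_pos rfl, h1]
      · rw [if_neg hlm.symm, if_neg hne, h2]
      · rw [if_neg hlu.symm, hru, h3]; exact ite_self 0
      · rw [if_neg hlf.symm, hrf, h4]; exact ite_self 0
    rw [h1, degree_quad] at hw2
    omega
  -- (VT-u): the free letter is untranslated
  have hnf : coeff ((c k).r + (Finsupp.single (j k) 2 + Finsupp.single mu 1 + Finsupp.single u 2)) (c k).F = 0 := by
    by_contra h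
    have hmem := mem_support_iff.mpr h
    rw [hradd] at hmem
    obtain ⟨-, -, h3, h4⟩ := quad_apply hlm hlu hlf hmu hmf huf (1 + 2) (1 + 1) 2 0
    exact hrow _ hmem (by rw [degree_quad]; omega) ⟨h3, h4⟩
  have hW : coeff ((c k).r + (Finsupp.single mu 1 + Finsupp.single u 4)) (c k).F = 0 := by
    have heq : (c k).r + (Finsupp.single mu 1 + Finsupp.single u 4) =
        Finsupp.single (j k) 1 + Finsupp.single mu (1 + 1) + Finsupp.single u 4 + Finsupp.single f 0 := by
      rw [hr, Finsupp.single_add, Finsupp.single_zero, add_zero]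
      abel
    by_contra h
    have hmem := mem_support_iff.mpr h
    rw [heq] at hmem
    obtain ⟨h1, -, -, h4⟩ := quad_apply hlm hlu hlf hmu hmf huf 1 (1 + 1) 4 0
    have h2 := hled _ hmem (by rw [h4]; omega) (by rw [degree_quad]; omega)
    rw [h1] at h2
    omega
  have hbu : b k u = 0 :=
    cInf_translation_u_eq_zero 5 hc hw hr0 hfloor (by norm_num) hshade hk hform' hlam rfl hlm.symm hlu.symm
      hlf.symm hmu huf.symm hmf.symm hstraight hbm hbf hnf hV hW
  -- so the step is a pure corner
  have hb0 : b k = 0 := by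
    funext i
    rcases letters_exhaust hlm hlu hlf hmu hmf huf i with h | h | h | h <;> rw [h]
    · exact hbj
    · exact hbm
    · exact hbu
    · exact hbf
  have hstep0 : c (k + 1) = CentreBlowup.step 5 Finset.univ (j k) 0 (c k) := by rw [hstepw, hb0]
  -- the ledger is reproduced
  have hr' : (c (k + 1)).r = Finsupp.single (j k) 1 + Finsupp.single mu 1 := by
    rw [hstep0, cInf_step_zero_r hlm (Or.inl rfl) hr ho, hr]
  obtain ⟨o', ho', -, -, hod'⟩ := chain_shade_nat 5 hc hfloor hshade (k := k + 1) (by omega)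
  have ho'6 : o' = 6 := by omega
  subst ho'6
  -- the child form is straight: the tilt identity at `x_f³`
  have hℓf : ℓ f ≠ 0 := by
    intro h0
    apply hℓ
    funext i
    by_cases hi : i = f
    · rw [hi]; exact h0
    · exact hstraight i hi
  have ha' : a' ≠ 0 := by
    intro h0
    apply resForm_ne_zero ho' hdivk1
    rw [hform', h0, C_0, zero_mul]
  have hstraight' : ∀ i, i ≠ f → ℓ' i = 0 := by
    intro i hi
    rcases letters_exhaust hlm hlu hlf hmu hmf huf i with h | h | h | h
    · rw [h]
      have hμj : (Finsupp.single f 3 : Fin 4 →₀ ℕ) (j k) = 0 := Finsupp.single_eq_of_ne hlf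
      have hμ : (Finsupp.single f 3 : Fin 4 →₀ ℕ).degree + 1 = 4 := by rw [Finsupp.degree_single]
      have ht := chain_tilt_identity 5 hc hw hr0 hfloor hshade hk hform' hlam hμj hμ
      -- right side: the reading `x^r x_λ² x_f³` vanishes by the ledger
      have hz : coeff (Finsupp.single f 3 + Finsupp.single (j k) 2) ((c k).F.divMonomial (c k).r) = 0 := by
        rw [coeff_divMonomial]
        by_contra h
        have hmem := mem_support_iff.mpr h
        have heq : (c k).r + (Finsupp.single f 3 + Finsupp.single (j k) 2) =
            Finsupp.single (j k) (1 + 2) + Finsupp.single mu 1 + Finsupp.single u 0 + Finsupp.single f 3 := by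
          rw [hr, Finsupp.single_add, Finsupp.single_zero, add_zero]
          abel
        rw [heq] at hmem
        obtain ⟨-, h2, -, h4⟩ := quad_apply hlm hlu hlf hmu hmf huf (1 + 2) 1 0 3
        have h2' := hled _ hmem (by rw [h4]) (by rw [degree_quad]; omega)
        rw [h2] at h2'
        omega
      rw [hb0, shear_zero, shear_zero, hz, mul_zero] at ht
      -- left side: `a′ · 4 · ℓ′_λ · λ³ · ℓ_f³`
      have hform0 : (∑ i, C (Function.update ℓ (j k) 0 i) * X i : MvPolynomial (Fin 4) K) = C (ℓ f) * X f := by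
        rw [Finset.sum_eq_single f]
        · rw [Function.update_of_ne hlf.symm]
        · intro i _ hif
          by_cases hij : i = j k
          · rw [hij, Function.update_self, C_0, zero_mul]
          · rw [Function.update_of_ne hij, hstraight i hif, C_0, zero_mul]
        · intro h; exact absurd (Finset.mem_univ f) h
      have hcoef : coeff (Finsupp.single f 3)
          ((∑ i, C (Function.update ℓ (j k) 0 i) * X i : MvPolynomial (Fin 4) K) ^ (4 - 1)) = ℓ f ^ 3 := by
        rw [hform0, mul_pow, ← C_pow, X_pow_eq_monomial, C_mul_monomial, coeff_monomial, if_pos rfl, mul_one]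
      rw [hcoef] at ht
      have h4 : ((4 : ℕ) : K) ≠ 0 := natCast_ne_zero_of_lt 5 (by norm_num) (by norm_num)
      by_contra hne
      exact mul_ne_zero (mul_ne_zero (mul_ne_zero (mul_ne_zero ha' h4) hne) (pow_ne_zero _ hlam0))
        (pow_ne_zero 3 hℓf) ht
    · rw [h, hlam mu hlm.symm, hstraight mu hmf, mul_zero]
    · rw [h, hlam u hlu.symm, hstraight u huf, mul_zero]
    · exact absurd h hi
  -- transport of the jet readings
  have hi1 : ∀ d ∈ (c k).F.support, 1 ≤ d mu := by
    intro d hd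
    have h := hdivk d hd mu
    rw [hrm] at h
    exact h
  have h7 := seven_le_degree_of_straight ho hdivk hform hstraight hrf
  have h5 : ∀ d ∈ (c k).F.support, 5 ≤ d.degree := fun d hd => by
    have h := le_degree_of_mem_support_of_ordZero ho hd; omega
  have hled' := ledger_step_zero hlm hlu hlf hmu hmf huf (c k) hi1 h7 hled
  have hrow' := row_step_zero hlm hlu hlf hmu hmf huf (c k) hi1 h5 hrow
  have hV' := cInf_uFlag_step_zero hlm hlu.symm hmu.symm (Or.inl rfl) hr ho hV
  rw [← hstep0] at hled' hrow' hV'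
  exact ⟨hb0, hstep0, hr', hstraight', hled', hrow', hV'⟩

end Chain

end ResCone

end Summit.ResolutionOfSingularities.ResolutionOfSingularities.Theorems.PIDim4
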